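import Summits.RiemannHypothesis.RiemannHypothesis.Theorems.GapsEvoDoorsWindowCriterion
import Summits.RiemannHypothesis.RiemannHypothesis.Theses.GapsEvoDoors

/-!
# GapsEvoDoors — item 22422 `FFSpacingCriterionAll`: the two-sided fragment spacing criterion

Item stmt-RiemannHypothesis-22422 of route GapsEvoDoors (cell rh-gaps; analytic support of the
FIRST registered skeleton on crux `FragmentToCI`, Bui–Goldston–Milinovich–Montgomery 2023
Proposition 1 / Theorem 3 with the form factor pinned to `1 ± ε` on a window): for every `Δ ≥ 1`
and `ε ≥ 0`, if for all large `T` `|F(α, T) − 1| ≤ ε` on `1 < |α| ≤ Δ` and RH holds, then every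
`λ > 0` and every admissible `r` (even, continuous, `L¹`, `r̂ ∈ L¹`, `r ≤ 1`, `r ≤ 0` off
`[−λ, λ]`, `r̂ ≥ 0` for `|α| ≥ Δ`) with
`c(r; Δ, ε) = r̂(0) − 1 + 2∫₀¹ α r̂ + 2∫₁^Δ ((1 − ε) r̂⁺ − (1 + ε) r̂⁻) > 0` force
`SpacingDensityPos λ`.

PROOF: the window criterion `GapsEvoDoorsWindow.spacingDensityPos_window` with the minorant
`m = (1 − ε) max(r̂, 0) − (1 + ε) max(−r̂, 0)`: where `r̂ ≥ 0`, `F ≥ 1 − ε` gives `m = (1 − ε) r̂ ≤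
F r̂`; where `r̂ < 0`, `F ≤ 1 + ε` gives `m = (1 + ε) r̂ ≤ F r̂`. At `Δ = 1` (empty window, `r̂ ≥ 0`
everywhere) this is the tree's `BGMM2023.spacingDensityPos_of_RH`. RH and the fragment are
HYPOTHESES; nothing here bears on the truth of RH.
-/

noncomputable section

open Filter Set MeasureTheory Real

set_option linter.dupNamespace false  -- the mandated namespace repeats `RiemannHypothesis`

namespace Summit.RiemannHypothesis.RiemannHypothesis.Theorems.GapsEvoDoorsWindow

open Literature.NumberTheory.LFunctions Literature.NumberTheory.LFunctions.BGMM2023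

/-- **Item stmt-RiemannHypothesis-22422 (`FFSpacingCriterionAll`) holds**: the two-sided fragment
`|F − 1| ≤ ε` on `1 < |α| ≤ Δ`, RH and a positive certificate `c(r; Δ, ε)` give a positive
proportion of spacings `≤ 2πλ/log T` — the window criterion with minorant
`m = (1 − ε) r̂⁺ − (1 + ε) r̂⁻`. -/
theorem FFSpacingCriterionAll_holds :
    Summit.RiemannHypothesis.RiemannHypothesis.Theses.GapsEvoDoors.FFSpacingCriterionAll := by
  unfold Summit.RiemannHypothesis.RiemannHypothesis.Theses.GapsEvoDoors.FFSpacingCriterionAll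
  intro Δ ε hΔ hε hfrag hRH lam r hlam hev hco hin hti hle hno htail hc
  have hge : ∀ a, cosTransform r (-a) = cosTransform r a := cosTransform_neg r
  have hgc : Continuous (cosTransform r) := continuous_cosTransform hev hin
  obtain ⟨T₀, hT₀⟩ := hfrag
  refine spacingDensityPos_window hRH hlam hΔ hev hco hin hti hle hno htail
    (m := fun a ↦ (1 - ε) * max (cosTransform r a) 0 - (1 + ε) * max (-cosTransform r a) 0)
    (by fun_prop) (fun a ↦ by simp only [hge]) ⟨T₀, fun T hT α h1 h2 ↦ ?_⟩ hc
  have hF := abs_le.1 (hT₀ T hT α h1 h2)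
  rcases le_or_gt 0 (cosTransform r α) with hg | hg
  · rw [max_eq_left hg, max_eq_right (by linarith), mul_zero, sub_zero]
    exact mul_le_mul_of_nonneg_right (by linarith [hF.1]) hg
  · rw [max_eq_right hg.le, max_eq_left (by linarith), mul_zero, zero_sub]
    have h3 : montgomeryFormFactor α T ≤ 1 + ε := by linarith [hF.2]
    nlinarith [h3, hg]

end Summit.RiemannHypothesis.RiemannHypothesis.Theorems.GapsEvoDoorsWindow

end
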